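import Literature.NumberTheory.LFunctions.ZetaBProcessPhase
import HarnessLib

/-!
# The fifth derivative of the van der Corput dual of the differenced logarithmic phase

Topic `Literature/NumberTheory/LFunctions`. For the Weyl-differenced logarithmic phase
`φ_d(y) = (t/2π)(log y - log(y + d))` (`Literature.NumberTheory.LFunctions.VdC.dphase`; this is
`g_r(x) = f(x + r) - f(x)` for `f(x) = -(t/2π) log x`, `d = r`, of Patel–Yang 2024, proof of
Lemma 3.4) and its `B`-process dual `ψ(ν) = φ_d(x_ν) - νx_ν`, `φ_d'(x_ν) = ν`
(`Literature.NumberTheory.LFunctions.VdC.xsLog`, `…dualFamily`, file `ZetaBProcessPhase.lean`,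
derivatives up to order `4`), the explicit fifth-derivative test (`A³B(0,1)`, Patel–Yang (3.13),
Yang's Lemma 2.5 with `k = 5`) needs `ψ^{(5)}`. Everything here is PROVED:

* `Literature.NumberTheory.LFunctions.VdC.dualFamily5` — the family `E_j = ψ^{(j)}`, `j ≤ 5`,
  extending `dualFamily` by
  `E₅ = (φ⁽⁵⁾φ''² - 10 φ''φ'''φ'''' + 15 φ'''³)(x_ν)/φ''(x_ν)⁷` (the derivative of
  `E₄ = (φ''''φ'' - 3φ'''²)/φ''⁵ ∘ x_ν`, `x_ν' = 1/φ''(x_ν)`), a `DerivFamily` of order `5`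
  (`…dualFamily5_derivFamily`);
* `Literature.NumberTheory.LFunctions.VdC.dual_fifth_eq` — the closed form: with `p = 1/y`,
  `q = 1/(y+d)`, `K = t/2π`,
  `E₅ ∘ x⁻¹ = -24 Q/(K⁴ (p-q)⁴ (p+q)⁷)`, `Q = p⁶ + 3p⁵q + 9p⁴q² + 9p³q³ + 9p²q⁴ + 3pq⁵ + q⁶`;
  equivalently Patel–Yang (3.8): `|φ_r⁽⁵⁾(ν)| = (3/(2√π (x+2)^{7/2}))(8x³ + 36x² + 60x + 35)(tr)^{1/2}/ν^{9/2}`,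
  `x = πrν/t` (`x = (p-q)²/(2pq)`, `x + 2 = (p+q)²/(2pq)`); in particular `ψ⁽⁵⁾ < 0`.

## References

* D. Patel, A. Yang, *An explicit sub-Weyl bound for `ζ(1/2 + it)`*, J. Number Theory 262 (2024),
  proof of Lemma 3.4, eq. (3.8). [cite: PatelYang2024, (3.8)]
* S. W. Graham, G. Kolesnik, *Van der Corput's Method of Exponential Sums*, LMS LN 126 (1991),
  Lemma 3.9 (the dual phase).
-/

noncomputable section

open Real Set

namespace Literature.NumberTheory.LFunctions
namespace VdC

/-! ### Fifth derivatives of the phases -/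

/-- `phaseD (-t) 5 y = 24(t/2π)/y⁵`. [folklore] -/
theorem phaseD_negt_five (t y : ℝ) : phaseD (-t) 5 y = 24 * (t / (2 * π)) * (y ^ 5)⁻¹ := by
  have h : phaseD (-t) 5 y = -t / (2 * π) * (-1) ^ (4 + 1) * (Nat.factorial 4 : ℝ)
      * y ^ (-((4 : ℤ) + 1)) := phaseD_succ (-t) 4 y
  have hz : y ^ (-((4 : ℤ) + 1)) = (y ^ 5)⁻¹ := by
    rw [show (-((4 : ℤ) + 1)) = -((5 : ℕ) : ℤ) by norm_num, zpow_neg, zpow_natCast]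
  have h24 : (Nat.factorial 4 : ℝ) = 24 := by norm_num [Nat.factorial]
  rw [h, hz, h24]
  ring

/-- `φ_d⁽⁵⁾(y) = 24K(1/y⁵ - 1/(y+d)⁵)`. [folklore] -/
theorem dphase_five (t d y : ℝ) :
    dphase t d 5 y = 24 * (t / (2 * π)) * ((y ^ 5)⁻¹ - ((y + d) ^ 5)⁻¹) := by
  simp only [dphase, phaseD_negt_five]; ring

/-! ### The dual family up to order `5` -/

/-- The derivative family of the dual phase `ψ(ν) = φ_d(x_ν) - νx_ν` up to order `5`: orders `≤ 4`
as `Literature.NumberTheory.LFunctions.VdC.dualFamily`, and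
`E₅ = (φ⁽⁵⁾φ''² - 10φ''φ'''φ'''' + 15φ'''³)(x_ν)/φ''(x_ν)⁷`. [cite: PatelYang2024, (3.8)] -/
def dualFamily5 (t d : ℝ) : ℕ → ℝ → ℝ
  | 5 => fun ν => (dphase t d 5 (xsLog t d ν) * dphase t d 2 (xsLog t d ν) ^ 2
      - 10 * dphase t d 2 (xsLog t d ν) * dphase t d 3 (xsLog t d ν) * dphase t d 4 (xsLog t d ν)
      + 15 * dphase t d 3 (xsLog t d ν) ^ 3) / dphase t d 2 (xsLog t d ν) ^ 7
  | j => dualFamily t d j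

/-- Orders `≤ 4` agree with `dualFamily`. [folklore] -/
theorem dualFamily5_of_le {t d : ℝ} {j : ℕ} (hj : j ≤ 4) : dualFamily5 t d j = dualFamily t d j := by
  interval_cases j <;> rfl

/-- `E₀ = ψ`. [folklore] -/
theorem dualFamily5_zero (t d ν : ℝ) :
    dualFamily5 t d 0 ν = dphase t d 0 (xsLog t d ν) - ν * xsLog t d ν := rfl

/-- `E₅` in closed form over the derivatives of `φ_d` at `x_ν`. [folklore] -/
theorem dualFamily5_five (t d ν : ℝ) :
    dualFamily5 t d 5 ν = (dphase t d 5 (xsLog t d ν) * dphase t d 2 (xsLog t d ν) ^ 2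
      - 10 * dphase t d 2 (xsLog t d ν) * dphase t d 3 (xsLog t d ν) * dphase t d 4 (xsLog t d ν)
      + 15 * dphase t d 3 (xsLog t d ν) ^ 3) / dphase t d 2 (xsLog t d ν) ^ 7 := rfl

/-- **The order-`5` dual family is a derivative family on `(0, ∞)`**: `E_{j+1} = E_j'` for `j < 5`.
[cite: PatelYang2024, (3.8)] -/
theorem hasDerivAt_dualFamily5 {t d ν : ℝ} (ht : 0 < t) (hd : 0 < d) (hν : 0 < ν) (j : ℕ)
    (hj : j < 5) : HasDerivAt (dualFamily5 t d j) (dualFamily5 t d (j + 1) ν) ν := by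
  rcases Nat.lt_succ_iff.1 hj |>.lt_or_eq with hj4 | rfl
  · -- `j < 4`: from the tree
    have h := hasDerivAt_dualFamily ht hd hν j hj4
    have e1 : dualFamily5 t d j = dualFamily t d j := funext fun ν => by
      rw [dualFamily5_of_le hj4.le]
    have e2 : dualFamily5 t d (j + 1) ν = dualFamily t d (j + 1) ν := by
      rw [dualFamily5_of_le (by omega : j + 1 ≤ 4)]
    rw [e1, e2]; exact h
  · -- `j = 4`: differentiate `E₄ = (φ''''φ'' - 3φ'''²)/φ''⁵ ∘ x_ν`
    have hx := xsLog_pos ht hd hν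
    have hxs := hasDerivAt_xsLog ht hd hν
    have h2ne : dphase t d 2 (xsLog t d ν) ≠ 0 := (dphase_two_xsLog_neg ht hd hν).ne
    have e1 : dualFamily5 t d 4 = fun ν => (dphase t d 4 (xsLog t d ν) * dphase t d 2 (xsLog t d ν)
        - 3 * dphase t d 3 (xsLog t d ν) ^ 2) / dphase t d 2 (xsLog t d ν) ^ 5 := by
      funext ν; rfl
    rw [e1, dualFamily5_five]
    have hg2 := (hasDerivAt_dphase t hd.le hx 2).comp ν hxs
    have hg3 := (hasDerivAt_dphase t hd.le hx 3).comp ν hxs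
    have hg4 := (hasDerivAt_dphase t hd.le hx 4).comp ν hxs
    have hnum := (hg4.mul hg2).sub ((hg3.pow 2).const_mul 3)
    have hden := hg2.pow 5
    have h := hnum.div hden (pow_ne_zero 5 h2ne)
    refine h.congr_deriv ?_
    simp only [Function.comp_apply, Pi.pow_apply, Pi.sub_apply, Pi.mul_apply]
    push_cast
    field_simp
    ring

/-- The order-`5` dual family is a `DerivFamily` of order `5` on `[a, b]`, `0 < a`. [folklore] -/
theorem dualFamily5_derivFamily {t d a b : ℝ} (ht : 0 < t) (hd : 0 < d) (ha : 0 < a) :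
    DerivFamily (dualFamily5 t d) a b 5 :=
  fun j hj _ hν => hasDerivAt_dualFamily5 ht hd (ha.trans_le hν.1) j hj

/-! ### The closed form of `E₅` -/

/-- **The fifth derivative of the dual phase in closed form**: with `p = 1/y`, `q = 1/(y+d)`,
`K = t/2π`: `(φ⁽⁵⁾φ''² - 10φ''φ'''φ'''' + 15φ'''³)/φ''⁷ = -24 Q/(K⁴(p-q)⁴(p+q)⁷)`,
`Q = p⁶ + 3p⁵q + 9p⁴q² + 9p³q³ + 9p²q⁴ + 3pq⁵ + q⁶` (Patel–Yang (3.8) in the variables `p, q`).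
[cite: PatelYang2024, (3.8)] -/
theorem dual_fifth_eq {t d y : ℝ} (ht : 0 < t) (hy : 0 < y) (hd : 0 < d) :
    (dphase t d 5 y * dphase t d 2 y ^ 2 - 10 * dphase t d 2 y * dphase t d 3 y * dphase t d 4 y
        + 15 * dphase t d 3 y ^ 3) / dphase t d 2 y ^ 7
      = -(24 * (y⁻¹ ^ 6 + 3 * y⁻¹ ^ 5 * (y + d)⁻¹ + 9 * y⁻¹ ^ 4 * (y + d)⁻¹ ^ 2
          + 9 * y⁻¹ ^ 3 * (y + d)⁻¹ ^ 3 + 9 * y⁻¹ ^ 2 * (y + d)⁻¹ ^ 4 + 3 * y⁻¹ * (y + d)⁻¹ ^ 5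
          + (y + d)⁻¹ ^ 6))
        / ((t / (2 * π)) ^ 4 * (y⁻¹ - (y + d)⁻¹) ^ 4 * (y⁻¹ + (y + d)⁻¹) ^ 7) := by
  have hK : 0 < t / (2 * π) := by positivity
  have hyd : 0 < y + d := by linarith
  set K : ℝ := t / (2 * π) with hKdef
  set p : ℝ := y⁻¹ with hp
  set q : ℝ := (y + d)⁻¹ with hq
  have hq0 : 0 < q := by positivity
  have hpq : 0 < p - q := by
    rw [hp, hq, inv_sub_inv_add_eq hy hyd]; positivity
  have hpq' : 0 < p + q := by positivity
  have h2 : dphase t d 2 y = -K * ((p - q) * (p + q)) := by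
    rw [dphase_two, hp, hq, ← inv_pow, ← inv_pow]; ring
  have h3 : dphase t d 3 y = 2 * K * ((p - q) * (p ^ 2 + p * q + q ^ 2)) := by
    rw [dphase_three, hp, hq, ← inv_pow, ← inv_pow]; ring
  have h4 : dphase t d 4 y = -(6 * K) * ((p - q) * (p + q) * (p ^ 2 + q ^ 2)) := by
    rw [dphase_four, hp, hq, ← inv_pow, ← inv_pow]; ring
  have h5 : dphase t d 5 y = 24 * K * ((p - q) * (p ^ 4 + p ^ 3 * q + p ^ 2 * q ^ 2 + p * q ^ 3 + q ^ 4)) := by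
    rw [dphase_five, hp, hq, ← inv_pow, ← inv_pow]; ring
  rw [h2, h3, h4, h5]
  have hne1 : (p - q) ≠ 0 := hpq.ne'
  have hne2 : (p + q) ≠ 0 := hpq'.ne'
  have hne3 : K ≠ 0 := hK.ne'
  field_simp
  ring

/-- `E₅ < 0`: the fifth derivative of the dual phase is negative (`ν > 0`). [cite: PatelYang2024, (3.8)] -/
theorem dualFamily5_five_neg {t d ν : ℝ} (ht : 0 < t) (hd : 0 < d) (hν : 0 < ν) :
    dualFamily5 t d 5 ν < 0 := by
  have hx := xsLog_pos ht hd hν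
  rw [dualFamily5_five, dual_fifth_eq ht hx hd]
  set y := xsLog t d ν
  have hyd : 0 < y + d := by linarith
  have hp : 0 < y⁻¹ := inv_pos.2 hx
  have hq : 0 < (y + d)⁻¹ := inv_pos.2 hyd
  have hpq : 0 < y⁻¹ - (y + d)⁻¹ := by rw [inv_sub_inv_add_eq hx hyd]; positivity
  have hK : 0 < t / (2 * π) := by positivity
  apply div_neg_of_neg_of_pos
  · have : 0 < y⁻¹ ^ 6 + 3 * y⁻¹ ^ 5 * (y + d)⁻¹ + 9 * y⁻¹ ^ 4 * (y + d)⁻¹ ^ 2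
        + 9 * y⁻¹ ^ 3 * (y + d)⁻¹ ^ 3 + 9 * y⁻¹ ^ 2 * (y + d)⁻¹ ^ 4 + 3 * y⁻¹ * (y + d)⁻¹ ^ 5
        + (y + d)⁻¹ ^ 6 := by positivity
    linarith
  · positivity

end VdC
end Literature.NumberTheory.LFunctions
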